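import Literature.AlgebraicGeometry.Resolution.PrimeDivisorIdeals
import Literature.AlgebraicGeometry.Resolution.StalkIdealLemmas
import Literature.AlgebraicGeometry.Resolution.ExceptionalCurvePoints
import HarnessLib

/-!
# Two distinct prime divisors on a locally factorial scheme: `𝓘_E ∩ 𝓘_F = 𝓘_E · 𝓘_F`
# (Lipman 1969, §13: `𝒪(−E)𝒪(−F) = 𝒪(−E−F)` defines the curve `E + F`, the union of `E` and `F`)

Topic: `Literature/AlgebraicGeometry/Resolution`.  PROVED, fact-free, definition-free.  J. Lipman, *Rational
singularities …*, Publ. Math. IHÉS 36 (1969), §13 (p. 223) writes `E + F` for "the curve with ideal `𝒪(−E)𝒪(−F)`";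
for two DISTINCT integral curves `E = cl{ζ}`, `F = cl{ζ′}` on a regular (more generally locally factorial) `X`
this product of invertible ideals is the INTERSECTION `𝓘_E ∩ 𝓘_F`, the ideal of the reduced union `E ∪ F`
(stalkwise: two non-associated prime elements `p`, `p′` of the factorial local ring `𝒪_{X,x}` satisfy
`(p) ∩ (p′) = (pp′)`; Görtz–Wedhorn I, Thm. 11.40 with Prop. B.75).  Together with the inclusion–exclusion
`h⁰(𝒪/(𝓐∩𝓑)) + h⁰(𝒪/(𝓐+𝓑)) = h⁰(𝒪/𝓐) + h⁰(𝒪/𝓑)` (`Resolution/RationalResolutionH0InclusionExclusion`) this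
gives Lipman's `χ(E) + χ(F) − χ(E+F) = h⁰(𝒪_{E∩F})` for the curve `E + F = V(𝓘_E𝓘_F)` (proof of (13.1) d)).

* `primeOfSpecializes_injective` — distinct generisations `ζ ≠ ζ′` of a point `x` have distinct primes
  `𝔭_ζ ≠ 𝔭_{ζ′}` in `𝒪_{X,x}`;
* `Ideal.span_singleton_inf_span_singleton_of_not_dvd` — `(p) ∩ (p′) = (p p′)` for a prime `p′ ∤`-free of `p`;
* **`primeDivisorIdeal_inf_eq_mul`** — `𝓘_ζ ⊓ 𝓘_{ζ′} = 𝓘_ζ * 𝓘_{ζ′}` for `ζ ≠ ζ′` of coheight one on an integral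
  scheme with factorial local rings; `…_of_isRegular`; `IsResolution.primeDivisorIdeal_inf_eq_mul` — for two
  distinct integral exceptional curves `η ≠ η′ ∈ excCurvePoints π` of a resolution of a two-dimensional local domain.

## References
* J. Lipman, Publ. Math. IHÉS 36 (1969), §13 (p. 223). [Lipman1969]
* U. Görtz, T. Wedhorn, *Algebraic Geometry I* (2nd ed. 2020), Thm. 11.40, Prop. B.75. [GortzWedhorn2020]
-/

noncomputable section

open CategoryTheory AlgebraicGeometry TopologicalSpace IsLocalRing
open Scheme.IdealSheafData

namespace Literature.AlgebraicGeometry.Resolution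

universe u

variable {X : Scheme.{u}}

/-! ## Distinct generisations have distinct primes -/

/-- **Distinct generisations `ζ ≠ ζ′` of `x` give distinct primes `𝔭_ζ ≠ 𝔭_{ζ′} ⊆ 𝒪_{X,x}`** (the points of
`Spec 𝒪_{X,x}` are the generisations of `x`). [cite: StacksProject, Tag 01J7] -/
theorem primeOfSpecializes_injective {ζ ζ' x : X} (h : ζ ⤳ x) (h' : ζ' ⤳ x)
    (heq : primeOfSpecializes h = primeOfSpecializes h') : ζ = ζ' := by
  obtain ⟨U, hU, hxU, -⟩ :=
    exists_isAffineOpen_mem_and_subset (X := X) (x := x) (U := ⊤) (Opens.mem_top x)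
  have e := comap_germ_primeOfSpecializes h ⟨U, hU⟩ hxU
  rw [heq, comap_germ_primeOfSpecializes h' ⟨U, hU⟩ hxU] at e
  have e' : hU.primeIdealOf ⟨ζ', h'.mem_open U.isOpen hxU⟩ = hU.primeIdealOf ⟨ζ, h.mem_open U.isOpen hxU⟩ :=
    PrimeSpectrum.ext e
  have h1 := hU.fromSpec_primeIdealOf ⟨ζ', h'.mem_open U.isOpen hxU⟩
  rw [e', hU.fromSpec_primeIdealOf] at h1
  exact h1

/-! ## `(p) ∩ (p′) = (p p′)` for non-associated primes -/

/-- In a commutative ring, for `p′` prime not dividing `p`: `(p) ∩ (p′) = (p·p′)`. [cite: GortzWedhorn2020, Prop. B.75] -/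
theorem Ideal.span_singleton_inf_span_singleton_of_not_dvd {R : Type*} [CommRing R] {p p' : R}
    (hp' : Prime p') (hnd : ¬ p' ∣ p) :
    Ideal.span {p} ⊓ Ideal.span {p'} = Ideal.span {p * p'} := by
  apply le_antisymm
  · rintro x ⟨hxp, hxp'⟩
    rw [SetLike.mem_coe, Ideal.mem_span_singleton] at hxp hxp'
    rw [Ideal.mem_span_singleton]
    obtain ⟨y, rfl⟩ := hxp
    rcases hp'.dvd_or_dvd hxp' with h1 | h1
    · exact absurd h1 hnd
    · exact mul_dvd_mul_left p h1
  · rw [le_inf_iff, Ideal.span_singleton_le_span_singleton, Ideal.span_singleton_le_span_singleton]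
    exact ⟨dvd_mul_right _ _, dvd_mul_left _ _⟩

/-! ## `𝓘_E ∩ 𝓘_F = 𝓘_E 𝓘_F` for distinct prime divisors -/

/-- **`𝓘_E ∩ 𝓘_F = 𝓘_E · 𝓘_F` for two distinct prime divisors `E = cl{ζ}`, `F = cl{ζ′}`** (`coheight = 1`,
`ζ ≠ ζ′`) on an integral scheme whose local rings are factorial: stalkwise at `x`, `(𝓘_E)_x`, `(𝓘_F)_x` are
`𝒪_{X,x}`, or principal primes `(p)`, `(p′)` with `p`, `p′` non-associated (their ideals are the distinct primes
`𝔭_ζ ≠ 𝔭_{ζ′}`), and `(p) ∩ (p′) = (pp′)`. This is the ideal `𝒪(−E)𝒪(−F)` of Lipman's curve `E + F`.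
[cite: Lipman1969, Section 13 (p. 223)] [cite: GortzWedhorn2020, Thm. 11.40 (2)] -/
theorem primeDivisorIdeal_inf_eq_mul [IsIntegral X]
    (hX : ∀ x : X, UniqueFactorizationMonoid (X.presheaf.stalk x)) {ζ ζ' : X}
    (hζ : Order.coheight ζ = 1) (hζ' : Order.coheight ζ' = 1) (hne : ζ ≠ ζ') :
    primeDivisorIdeal ζ ⊓ primeDivisorIdeal ζ' = primeDivisorIdeal ζ * primeDivisorIdeal ζ' := by
  apply le_antisymm
  · refine le_of_forall_stalkIdeal_le fun x => ?_
    rw [stalkIdeal_inf, stalkIdeal_mul]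
    by_cases h : ζ ⤳ x
    · by_cases h' : ζ' ⤳ x
      · haveI := hX x
        obtain ⟨p, hp, hpeq⟩ := exists_prime_primeOfSpecializes_eq_span h hζ
        obtain ⟨p', hp', hp'eq⟩ := exists_prime_primeOfSpecializes_eq_span h' hζ'
        rw [stalkIdeal_primeDivisorIdeal h, stalkIdeal_primeDivisorIdeal h', hpeq, hp'eq,
          Ideal.span_singleton_mul_span_singleton]
        -- `p′ ∤ p`: otherwise `(p) = (p′)`, i.e. `𝔭_ζ = 𝔭_{ζ′}`, i.e. `ζ = ζ′`
        have hnd : ¬ p' ∣ p := fun hdvd => hne <| primeOfSpecializes_injective h h' <| by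
          rw [hpeq, hp'eq]
          exact Ideal.span_singleton_eq_span_singleton.mpr
            (hp'.irreducible.associated_of_dvd hp.irreducible hdvd).symm
        exact (Ideal.span_singleton_inf_span_singleton_of_not_dvd hp' hnd).le
      · rw [stalkIdeal_primeDivisorIdeal_eq_top h', inf_top_eq, Ideal.mul_top]
    · rw [stalkIdeal_primeDivisorIdeal_eq_top h, top_inf_eq, Ideal.top_mul]
  · intro U
    rw [ideal_inf, ideal_mul, Pi.inf_apply, Pi.mul_apply]
    exact Ideal.mul_le_inf

/-- The same on a regular integral locally Noetherian scheme (Auslander–Buchsbaum: regular local rings are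
factorial). [cite: GortzWedhorn2020, Thm. 11.40 (2)] -/
theorem primeDivisorIdeal_inf_eq_mul_of_isRegular [IsIntegral X] (hX : Scheme.IsRegular X) {ζ ζ' : X}
    (hζ : Order.coheight ζ = 1) (hζ' : Order.coheight ζ' = 1) (hne : ζ ≠ ζ') :
    primeDivisorIdeal ζ ⊓ primeDivisorIdeal ζ' = primeDivisorIdeal ζ * primeDivisorIdeal ζ' :=
  primeDivisorIdeal_inf_eq_mul hX.uniqueFactorizationMonoid_stalk hζ hζ' hne

/-- **Two distinct integral exceptional curves `E_η ≠ E_{η′}` of a desingularization of a surface germ: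
`𝓘_η ∩ 𝓘_{η′} = 𝓘_η 𝓘_{η′}`** — for `T` a Noetherian local domain of Krull dimension `2`, `π : X → Spec T` a
resolution and `η ≠ η′ ∈ excCurvePoints π` (points over the closed point with one-dimensional closure, i.e. of
codimension one on the regular surface `X`, `IsResolution.coheight_eq_one_of_mem_excCurvePoints`). So Lipman's
curve `E + F = V(𝓘_E𝓘_F)` is the reduced union `E ∪ F = V(𝓘_E ∩ 𝓘_F)`. [cite: Lipman1969, Section 13 (p. 223)] -/
theorem IsResolution.primeDivisorIdeal_inf_eq_mul {T : Type u} [CommRing T] [IsNoetherianRing T]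
    [IsLocalRing T] [IsDomain T] (h2 : ringKrullDim T = 2) {X : Scheme.{u}} {π : X ⟶ Spec (.of T)}
    (hπ : IsResolution π) {η η' : X} (hη : η ∈ excCurvePoints π) (hη' : η' ∈ excCurvePoints π)
    (hne : η ≠ η') :
    primeDivisorIdeal η ⊓ primeDivisorIdeal η' = primeDivisorIdeal η * primeDivisorIdeal η' := by
  haveI : IsIntegral X := hπ.isIntegral_source
  exact primeDivisorIdeal_inf_eq_mul_of_isRegular hπ.isRegular
    (hπ.coheight_eq_one_of_mem_excCurvePoints h2 hη) (hπ.coheight_eq_one_of_mem_excCurvePoints h2 hη') hne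

end Literature.AlgebraicGeometry.Resolution

end
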